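import Mathlib
import HarnessLib
import Summits.ValiantsHypothesis.ValiantsHypothesis.Theorems.LacunarySymmetroidMatrixDescartesOsculationLawRankOneCurve

/-!
# ValiantsHypothesis / LacunarySymmetroid — crux `MatrixDescartes` (stmt-ValiantsHypothesis-18050, V1),
# line `Cruxes/MatrixDescartes/Lines/osculation_law.lean` (val-idea-2 g2, «osculation-law»), stub `stub_rankOne`

This file proves the line's bookkeeping stub **`stub_rankOne`** (size M, the explicit resultant form at rank
`r = 1`): for a symmetric block pencil `G(t) = Σ_l t^{d_l} S_l` on `Fin 1 ⊕ Fin s`, if the osculation set of the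
spectral curve `det(G(t) + b·(I₁ ⊕ 0)) = 0` in the open quadrant is finite, then

  `#osculationSet ≤ Z₊mult( W(det G)·(det G₂₂)² − W(det G₂₂)·(det G)² )`,  `W(h) = h·θ²h − (θh)²`, `θ = X d/dX`,

with the line's local vocabulary (`blockProj`, `insertionPoly`, `euler`, `logHessian`, `osculationSet`,
`posRootsMult`, `blockDet`, `lowerDet`, `eulerX`, `logWronskian`) UNFOLDED to Mathlib terms (the line file lives
under `Cruxes/` and carries the other stubs' `sorry`s, so it cannot be imported here; the two statements agree
definitionally — checked by `exact` against a verbatim copy of the line's definitions in the seat's scratch — so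
the line closes its stub by `exact …OsculationRankOne.stub_rankOne s K d S hS hfin`).

Proof: the rank-one update along `e_{inl 0}` over the commutative ring `ℝ[X₀,X₁]`,
`det(M + c·(I₁ ⊕ 0)) = det M + c·det M₂₂` (row linearity of `det` + `det_fromBlocks_zero₁₂`), gives
`insertionPoly = ι(det G) + X₁·ι(det G₂₂)` (`ι = Polynomial.aeval (X 0)`, `ι(det N) = det(N.map ι)`); then the
rank-one curve lemma `OsculationRankOne.osc_ncard_le` of `…OsculationLawRankOneCurve` applies verbatim.  The
symmetry hypothesis of the stub is idle at rank one.

Honest framing: a bookkeeping lemma on an UNREGISTERED alternative line of the V1 crux; the line's theorem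
`stub_peel` (PeelInequality), its LAW `stub_osculationLaw` (OsculationLaw, Conjecture-B strength),
`stub_recursion`, the crux `MatrixDescartes`, Conjecture B and `VP ≠ VNP` are all OPEN / NOT proved, and nothing
here is progress on them.  No definitions, no named facts; Mathlib only.
-/

-- `Summit.ValiantsHypothesis.ValiantsHypothesis.…` is the tree's mandated single-conjunct layout (Sub = Summit).
set_option linter.dupNamespace false

noncomputable section

namespace Summit.ValiantsHypothesis.ValiantsHypothesis.Theorems.LacunarySymmetroidMatrixDescartes

open Polynomial Matrix Finset
open scoped BigOperators

namespace OsculationRankOne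
/-- Rank-one update of the `(inl 0, inl 0)` entry: `det (M + c • (I₁ ⊕ 0)) = det M + c · det M₂₂`. -/
theorem det_add_smul_blockProj {R : Type*} [CommRing R] {s : ℕ}
    (M : Matrix (Fin 1 ⊕ Fin s) (Fin 1 ⊕ Fin s) R) (c : R) :
    (M + c • Matrix.fromBlocks (1 : Matrix (Fin 1) (Fin 1) R) 0 0 (0 : Matrix (Fin s) (Fin s) R)).det =
      M.det + c * (M.toBlocks₂₂).det := by
  classical
  have hupd : M + c • Matrix.fromBlocks (1 : Matrix (Fin 1) (Fin 1) R) 0 0 (0 : Matrix (Fin s) (Fin s) R) =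
      M.updateRow (Sum.inl 0) (M (Sum.inl 0) + c • Pi.single (Sum.inl 0) 1) := by
    ext i j
    rcases i with i | i <;> rcases j with j | j
    · have hi : i = 0 := Subsingleton.elim _ _
      have hj : j = 0 := Subsingleton.elim _ _
      subst hi; subst hj
      simp [Matrix.updateRow_apply, Matrix.fromBlocks_apply₁₁]
    · have hi : i = 0 := Subsingleton.elim _ _
      subst hi
      simp [Matrix.updateRow_apply, Matrix.fromBlocks_apply₁₂]
    · simp [Matrix.updateRow_apply, Matrix.fromBlocks_apply₂₁]
    · simp [Matrix.updateRow_apply, Matrix.fromBlocks_apply₂₂]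
  have hrow : M.updateRow (Sum.inl 0) (Pi.single (Sum.inl 0) (1 : R)) =
      Matrix.fromBlocks (1 : Matrix (Fin 1) (Fin 1) R) 0 M.toBlocks₂₁ M.toBlocks₂₂ := by
    ext i j
    rcases i with i | i <;> rcases j with j | j
    · have hi : i = 0 := Subsingleton.elim _ _
      have hj : j = 0 := Subsingleton.elim _ _
      subst hi; subst hj
      simp [Matrix.updateRow_apply, Matrix.fromBlocks_apply₁₁]
    · have hi : i = 0 := Subsingleton.elim _ _
      subst hi
      simp [Matrix.updateRow_apply, Matrix.fromBlocks_apply₁₂]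
    · simp [Matrix.updateRow_apply, Matrix.fromBlocks_apply₂₁, Matrix.toBlocks₂₁]
    · simp [Matrix.updateRow_apply, Matrix.fromBlocks_apply₂₂, Matrix.toBlocks₂₂]
  rw [hupd, Matrix.det_updateRow_add, Matrix.updateRow_eq_self, Matrix.det_updateRow_smul, hrow,
    Matrix.det_fromBlocks_zero₁₂, Matrix.det_one, one_mul]

/-! ### The insertion polynomial at rank one is `Φ = f + X₁ · a` -/

/-- The embedding `ι` maps the one-variable pencil `Σ X^{d_l} • T_l` to the pencil in `X₀`. [folklore] -/
theorem map_aevalX0_pencil {n K : ℕ} (d : Fin K → ℕ) (T : Fin K → Matrix (Fin n) (Fin n) ℝ) :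
    (∑ l, (X : ℝ[X]) ^ d l • (T l).map Polynomial.C).map
        (Polynomial.aeval (MvPolynomial.X 0 : MvPolynomial (Fin 2) ℝ)) =
      ∑ l, (MvPolynomial.X (0 : Fin 2) : MvPolynomial (Fin 2) ℝ) ^ d l •
        (T l).map (MvPolynomial.C : ℝ →+* MvPolynomial (Fin 2) ℝ) := by
  refine Matrix.ext fun i j => ?_
  simp only [Matrix.map_apply, Matrix.sum_apply, Matrix.smul_apply, map_sum, smul_eq_mul, map_mul, map_pow,
    Polynomial.aeval_X, Polynomial.aeval_C, MvPolynomial.algebraMap_eq]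

/-- Block-indexed copy of `map_aevalX0_pencil`. [folklore] -/
theorem map_aevalX0_pencil' {s K : ℕ} (d : Fin K → ℕ) (S : Fin K → Matrix (Fin 1 ⊕ Fin s) (Fin 1 ⊕ Fin s) ℝ) :
    (∑ l, (X : ℝ[X]) ^ d l • (S l).map Polynomial.C).map
        (Polynomial.aeval (MvPolynomial.X 0 : MvPolynomial (Fin 2) ℝ)) =
      ∑ l, (MvPolynomial.X (0 : Fin 2) : MvPolynomial (Fin 2) ℝ) ^ d l •
        (S l).map (MvPolynomial.C : ℝ →+* MvPolynomial (Fin 2) ℝ) := by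
  refine Matrix.ext fun i j => ?_
  simp only [Matrix.map_apply, Matrix.sum_apply, Matrix.smul_apply, map_sum, smul_eq_mul, map_mul, map_pow,
    Polynomial.aeval_X, Polynomial.aeval_C, MvPolynomial.algebraMap_eq]

/-- The lower block of the pencil is the pencil of the lower blocks. [folklore] -/
theorem toBlocks₂₂_pencil {s K : ℕ} (d : Fin K → ℕ) (S : Fin K → Matrix (Fin 1 ⊕ Fin s) (Fin 1 ⊕ Fin s) ℝ) :
    (∑ l, (MvPolynomial.X (0 : Fin 2) : MvPolynomial (Fin 2) ℝ) ^ d l •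
        (S l).map (MvPolynomial.C : ℝ →+* MvPolynomial (Fin 2) ℝ)).toBlocks₂₂ =
      ∑ l, (MvPolynomial.X (0 : Fin 2) : MvPolynomial (Fin 2) ℝ) ^ d l •
        ((S l).toBlocks₂₂).map (MvPolynomial.C : ℝ →+* MvPolynomial (Fin 2) ℝ) := by
  refine Matrix.ext fun i j => ?_
  simp [Matrix.toBlocks₂₂, Matrix.sum_apply, Matrix.smul_apply, Matrix.map_apply]

/-- `det (G(X₀) + X₁ • (I₁ ⊕ 0)) = ι(det G) + X₁ · ι(det G₂₂)`. -/
theorem insertionPoly_eq {s K : ℕ} (d : Fin K → ℕ) (S : Fin K → Matrix (Fin 1 ⊕ Fin s) (Fin 1 ⊕ Fin s) ℝ) :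
    (∑ l, (MvPolynomial.X (0 : Fin 2) : MvPolynomial (Fin 2) ℝ) ^ d l •
          (S l).map (MvPolynomial.C : ℝ →+* MvPolynomial (Fin 2) ℝ)
        + (MvPolynomial.X (1 : Fin 2) : MvPolynomial (Fin 2) ℝ) •
          (Matrix.fromBlocks 1 0 0 0 : Matrix (Fin 1 ⊕ Fin s) (Fin 1 ⊕ Fin s) ℝ).map
            (MvPolynomial.C : ℝ →+* MvPolynomial (Fin 2) ℝ)).det =
      Polynomial.aeval (MvPolynomial.X 0 : MvPolynomial (Fin 2) ℝ)
          (∑ l, (X : ℝ[X]) ^ d l • (S l).map Polynomial.C).det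
        + MvPolynomial.X 1 *
          Polynomial.aeval (MvPolynomial.X 0 : MvPolynomial (Fin 2) ℝ)
            (∑ l, (X : ℝ[X]) ^ d l • ((S l).toBlocks₂₂).map Polynomial.C).det := by
  have hP : (Matrix.fromBlocks 1 0 0 0 : Matrix (Fin 1 ⊕ Fin s) (Fin 1 ⊕ Fin s) ℝ).map
      (MvPolynomial.C : ℝ →+* MvPolynomial (Fin 2) ℝ) =
      Matrix.fromBlocks (1 : Matrix (Fin 1) (Fin 1) (MvPolynomial (Fin 2) ℝ)) 0 0
        (0 : Matrix (Fin s) (Fin s) (MvPolynomial (Fin 2) ℝ)) := by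
    rw [Matrix.fromBlocks_map, Matrix.map_one _ (map_zero _) (map_one _),
      Matrix.map_zero _ (map_zero _), Matrix.map_zero _ (map_zero _), Matrix.map_zero _ (map_zero _)]
  rw [hP, det_add_smul_blockProj, AlgHom.map_det, AlgHom.map_det, AlgHom.mapMatrix_apply,
    AlgHom.mapMatrix_apply, map_aevalX0_pencil', map_aevalX0_pencil, toBlocks₂₂_pencil]

/-- **`osculation_law :: stub_rankOne`** (the line's STUB 2, `r = 1`), with the line's `blockDet`, `lowerDet`,
`insertionPoly`, `blockProj`, `euler`, `logHessian`, `osculationSet`, `eulerX`, `logWronskian`, `posRootsMult`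
UNFOLDED verbatim: for a symmetric block pencil on `Fin 1 ⊕ Fin s`, if the osculation set of the spectral
curve `det(G(t) + b·(I₁ ⊕ 0)) = 0` in the open quadrant is finite, its cardinality is at most the number of
positive zeros (with multiplicity) of `W(det G)·(det G₂₂)² − W(det G₂₂)·(det G)²`.  The symmetry hypothesis is
idle at rank one. -/
theorem stub_rankOne (s K : ℕ) (d : Fin K → ℕ) (S : Fin K → Matrix (Fin 1 ⊕ Fin s) (Fin 1 ⊕ Fin s) ℝ)
    (_hS : ∀ l, (S l).IsSymm)
    (hfin : {p : Fin 2 → ℝ | 0 < p 0 ∧ 0 < p 1 ∧ MvPolynomial.eval p (∑ l, (MvPolynomial.X (0 : Fin 2) : MvPolynomial (Fin 2) ℝ) ^ d l •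
              (S l).map (MvPolynomial.C : ℝ →+* MvPolynomial (Fin 2) ℝ)
            + (MvPolynomial.X (1 : Fin 2) : MvPolynomial (Fin 2) ℝ) •
              (Matrix.fromBlocks 1 0 0 0 : Matrix (Fin 1 ⊕ Fin s) (Fin 1 ⊕ Fin s) ℝ).map
                (MvPolynomial.C : ℝ →+* MvPolynomial (Fin 2) ℝ)).det = 0 ∧
      MvPolynomial.eval p
        (MvPolynomial.X 0 * MvPolynomial.pderiv 0 (MvPolynomial.X 0 * MvPolynomial.pderiv 0 (∑ l, (MvPolynomial.X (0 : Fin 2) : MvPolynomial (Fin 2) ℝ) ^ d l •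
              (S l).map (MvPolynomial.C : ℝ →+* MvPolynomial (Fin 2) ℝ)
            + (MvPolynomial.X (1 : Fin 2) : MvPolynomial (Fin 2) ℝ) •
              (Matrix.fromBlocks 1 0 0 0 : Matrix (Fin 1 ⊕ Fin s) (Fin 1 ⊕ Fin s) ℝ).map
                (MvPolynomial.C : ℝ →+* MvPolynomial (Fin 2) ℝ)).det)
            * (MvPolynomial.X 1 * MvPolynomial.pderiv 1 (∑ l, (MvPolynomial.X (0 : Fin 2) : MvPolynomial (Fin 2) ℝ) ^ d l •
              (S l).map (MvPolynomial.C : ℝ →+* MvPolynomial (Fin 2) ℝ)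
            + (MvPolynomial.X (1 : Fin 2) : MvPolynomial (Fin 2) ℝ) •
              (Matrix.fromBlocks 1 0 0 0 : Matrix (Fin 1 ⊕ Fin s) (Fin 1 ⊕ Fin s) ℝ).map
                (MvPolynomial.C : ℝ →+* MvPolynomial (Fin 2) ℝ)).det) ^ 2
          - 2 * (MvPolynomial.X 0 * MvPolynomial.pderiv 0 (MvPolynomial.X 1 * MvPolynomial.pderiv 1 (∑ l, (MvPolynomial.X (0 : Fin 2) : MvPolynomial (Fin 2) ℝ) ^ d l •
              (S l).map (MvPolynomial.C : ℝ →+* MvPolynomial (Fin 2) ℝ)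
            + (MvPolynomial.X (1 : Fin 2) : MvPolynomial (Fin 2) ℝ) •
              (Matrix.fromBlocks 1 0 0 0 : Matrix (Fin 1 ⊕ Fin s) (Fin 1 ⊕ Fin s) ℝ).map
                (MvPolynomial.C : ℝ →+* MvPolynomial (Fin 2) ℝ)).det))
            * (MvPolynomial.X 0 * MvPolynomial.pderiv 0 (∑ l, (MvPolynomial.X (0 : Fin 2) : MvPolynomial (Fin 2) ℝ) ^ d l •
              (S l).map (MvPolynomial.C : ℝ →+* MvPolynomial (Fin 2) ℝ)
            + (MvPolynomial.X (1 : Fin 2) : MvPolynomial (Fin 2) ℝ) •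
              (Matrix.fromBlocks 1 0 0 0 : Matrix (Fin 1 ⊕ Fin s) (Fin 1 ⊕ Fin s) ℝ).map
                (MvPolynomial.C : ℝ →+* MvPolynomial (Fin 2) ℝ)).det) * (MvPolynomial.X 1 * MvPolynomial.pderiv 1 (∑ l, (MvPolynomial.X (0 : Fin 2) : MvPolynomial (Fin 2) ℝ) ^ d l •
              (S l).map (MvPolynomial.C : ℝ →+* MvPolynomial (Fin 2) ℝ)
            + (MvPolynomial.X (1 : Fin 2) : MvPolynomial (Fin 2) ℝ) •
              (Matrix.fromBlocks 1 0 0 0 : Matrix (Fin 1 ⊕ Fin s) (Fin 1 ⊕ Fin s) ℝ).map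
                (MvPolynomial.C : ℝ →+* MvPolynomial (Fin 2) ℝ)).det)
          + MvPolynomial.X 1 * MvPolynomial.pderiv 1 (MvPolynomial.X 1 * MvPolynomial.pderiv 1 (∑ l, (MvPolynomial.X (0 : Fin 2) : MvPolynomial (Fin 2) ℝ) ^ d l •
              (S l).map (MvPolynomial.C : ℝ →+* MvPolynomial (Fin 2) ℝ)
            + (MvPolynomial.X (1 : Fin 2) : MvPolynomial (Fin 2) ℝ) •
              (Matrix.fromBlocks 1 0 0 0 : Matrix (Fin 1 ⊕ Fin s) (Fin 1 ⊕ Fin s) ℝ).map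
                (MvPolynomial.C : ℝ →+* MvPolynomial (Fin 2) ℝ)).det)
            * (MvPolynomial.X 0 * MvPolynomial.pderiv 0 (∑ l, (MvPolynomial.X (0 : Fin 2) : MvPolynomial (Fin 2) ℝ) ^ d l •
              (S l).map (MvPolynomial.C : ℝ →+* MvPolynomial (Fin 2) ℝ)
            + (MvPolynomial.X (1 : Fin 2) : MvPolynomial (Fin 2) ℝ) •
              (Matrix.fromBlocks 1 0 0 0 : Matrix (Fin 1 ⊕ Fin s) (Fin 1 ⊕ Fin s) ℝ).map
                (MvPolynomial.C : ℝ →+* MvPolynomial (Fin 2) ℝ)).det) ^ 2) = 0}.Finite) :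
    {p : Fin 2 → ℝ | 0 < p 0 ∧ 0 < p 1 ∧ MvPolynomial.eval p (∑ l, (MvPolynomial.X (0 : Fin 2) : MvPolynomial (Fin 2) ℝ) ^ d l •
              (S l).map (MvPolynomial.C : ℝ →+* MvPolynomial (Fin 2) ℝ)
            + (MvPolynomial.X (1 : Fin 2) : MvPolynomial (Fin 2) ℝ) •
              (Matrix.fromBlocks 1 0 0 0 : Matrix (Fin 1 ⊕ Fin s) (Fin 1 ⊕ Fin s) ℝ).map
                (MvPolynomial.C : ℝ →+* MvPolynomial (Fin 2) ℝ)).det = 0 ∧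
      MvPolynomial.eval p
        (MvPolynomial.X 0 * MvPolynomial.pderiv 0 (MvPolynomial.X 0 * MvPolynomial.pderiv 0 (∑ l, (MvPolynomial.X (0 : Fin 2) : MvPolynomial (Fin 2) ℝ) ^ d l •
              (S l).map (MvPolynomial.C : ℝ →+* MvPolynomial (Fin 2) ℝ)
            + (MvPolynomial.X (1 : Fin 2) : MvPolynomial (Fin 2) ℝ) •
              (Matrix.fromBlocks 1 0 0 0 : Matrix (Fin 1 ⊕ Fin s) (Fin 1 ⊕ Fin s) ℝ).map
                (MvPolynomial.C : ℝ →+* MvPolynomial (Fin 2) ℝ)).det)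
            * (MvPolynomial.X 1 * MvPolynomial.pderiv 1 (∑ l, (MvPolynomial.X (0 : Fin 2) : MvPolynomial (Fin 2) ℝ) ^ d l •
              (S l).map (MvPolynomial.C : ℝ →+* MvPolynomial (Fin 2) ℝ)
            + (MvPolynomial.X (1 : Fin 2) : MvPolynomial (Fin 2) ℝ) •
              (Matrix.fromBlocks 1 0 0 0 : Matrix (Fin 1 ⊕ Fin s) (Fin 1 ⊕ Fin s) ℝ).map
                (MvPolynomial.C : ℝ →+* MvPolynomial (Fin 2) ℝ)).det) ^ 2
          - 2 * (MvPolynomial.X 0 * MvPolynomial.pderiv 0 (MvPolynomial.X 1 * MvPolynomial.pderiv 1 (∑ l, (MvPolynomial.X (0 : Fin 2) : MvPolynomial (Fin 2) ℝ) ^ d l •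
              (S l).map (MvPolynomial.C : ℝ →+* MvPolynomial (Fin 2) ℝ)
            + (MvPolynomial.X (1 : Fin 2) : MvPolynomial (Fin 2) ℝ) •
              (Matrix.fromBlocks 1 0 0 0 : Matrix (Fin 1 ⊕ Fin s) (Fin 1 ⊕ Fin s) ℝ).map
                (MvPolynomial.C : ℝ →+* MvPolynomial (Fin 2) ℝ)).det))
            * (MvPolynomial.X 0 * MvPolynomial.pderiv 0 (∑ l, (MvPolynomial.X (0 : Fin 2) : MvPolynomial (Fin 2) ℝ) ^ d l •
              (S l).map (MvPolynomial.C : ℝ →+* MvPolynomial (Fin 2) ℝ)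
            + (MvPolynomial.X (1 : Fin 2) : MvPolynomial (Fin 2) ℝ) •
              (Matrix.fromBlocks 1 0 0 0 : Matrix (Fin 1 ⊕ Fin s) (Fin 1 ⊕ Fin s) ℝ).map
                (MvPolynomial.C : ℝ →+* MvPolynomial (Fin 2) ℝ)).det) * (MvPolynomial.X 1 * MvPolynomial.pderiv 1 (∑ l, (MvPolynomial.X (0 : Fin 2) : MvPolynomial (Fin 2) ℝ) ^ d l •
              (S l).map (MvPolynomial.C : ℝ →+* MvPolynomial (Fin 2) ℝ)
            + (MvPolynomial.X (1 : Fin 2) : MvPolynomial (Fin 2) ℝ) •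
              (Matrix.fromBlocks 1 0 0 0 : Matrix (Fin 1 ⊕ Fin s) (Fin 1 ⊕ Fin s) ℝ).map
                (MvPolynomial.C : ℝ →+* MvPolynomial (Fin 2) ℝ)).det)
          + MvPolynomial.X 1 * MvPolynomial.pderiv 1 (MvPolynomial.X 1 * MvPolynomial.pderiv 1 (∑ l, (MvPolynomial.X (0 : Fin 2) : MvPolynomial (Fin 2) ℝ) ^ d l •
              (S l).map (MvPolynomial.C : ℝ →+* MvPolynomial (Fin 2) ℝ)
            + (MvPolynomial.X (1 : Fin 2) : MvPolynomial (Fin 2) ℝ) •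
              (Matrix.fromBlocks 1 0 0 0 : Matrix (Fin 1 ⊕ Fin s) (Fin 1 ⊕ Fin s) ℝ).map
                (MvPolynomial.C : ℝ →+* MvPolynomial (Fin 2) ℝ)).det)
            * (MvPolynomial.X 0 * MvPolynomial.pderiv 0 (∑ l, (MvPolynomial.X (0 : Fin 2) : MvPolynomial (Fin 2) ℝ) ^ d l •
              (S l).map (MvPolynomial.C : ℝ →+* MvPolynomial (Fin 2) ℝ)
            + (MvPolynomial.X (1 : Fin 2) : MvPolynomial (Fin 2) ℝ) •
              (Matrix.fromBlocks 1 0 0 0 : Matrix (Fin 1 ⊕ Fin s) (Fin 1 ⊕ Fin s) ℝ).map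
                (MvPolynomial.C : ℝ →+* MvPolynomial (Fin 2) ℝ)).det) ^ 2) = 0}.ncard ≤
      Multiset.card ((((∑ l, (X : ℝ[X]) ^ d l • (S l).map Polynomial.C).det * (X * derivative (X * derivative (∑ l, (X : ℝ[X]) ^ d l • (S l).map Polynomial.C).det))
            - (X * derivative (∑ l, (X : ℝ[X]) ^ d l • (S l).map Polynomial.C).det) ^ 2) * (∑ l, (X : ℝ[X]) ^ d l • ((S l).toBlocks₂₂).map Polynomial.C).det ^ 2
          - ((∑ l, (X : ℝ[X]) ^ d l • ((S l).toBlocks₂₂).map Polynomial.C).det * (X * derivative (X * derivative (∑ l, (X : ℝ[X]) ^ d l • ((S l).toBlocks₂₂).map Polynomial.C).det))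
            - (X * derivative (∑ l, (X : ℝ[X]) ^ d l • ((S l).toBlocks₂₂).map Polynomial.C).det) ^ 2) * (∑ l, (X : ℝ[X]) ^ d l • (S l).map Polynomial.C).det ^ 2).roots.filter (fun t => 0 < t)) :=
  osc_ncard_le _ _ _ (insertionPoly_eq d S) hfin

end OsculationRankOne

end Summit.ValiantsHypothesis.ValiantsHypothesis.Theorems.LacunarySymmetroidMatrixDescartes
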